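import Summits.QuantumFields.YangMills.Theorems.UnitScaleTiltProp7SymCentreAbelianFibre
import Summits.QuantumFields.YangMills.Theorems.AlphaInputsT3ACv3LinearLiftFluxLoopSum
import HarnessLib

/-!
# Route `UnitScaleTilt`, crux K1 child «MinimiserStabilityRegPr» (stmt-QuantumFields-19200), stub `stub_existenceMinimalOrbit` (EX), route (α), line «SYM-CENTRE»
# (★★OWNER RULING g28-№7 cure (ii-a), row (R4)) — **R4-FIBRE ∘ FLUX-LIFT §7: THE FLUX MEMBER'S FIBRE CONJUNCT FROM OFF-CORNER CURL ROWS, PER LEVEL**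

Cell `ym3-torus`, width seat `ym-ust-20520-w4` (gen 9).  THEOREMS ONLY (0 `def`, 0 `sorry`).  `--supports stmt-QuantumFields-19200 --as helper`, count-neutral.
YM₃ on T³ is a ladder rung (R3), not the Clay problem; nothing here claims the stub, the crux, d = 4 or the mass gap.

THE POINT.  ✓`Prop7SymCentreAbelianFibre.diag_mem_fibre_diag_of_loopSum_T3` (✓p676997) puts the abelian configuration `U_a = exp(a·iσ₃)` in the printed-averaging fibre of
`V_θ = exp(θ·iσ₃)` from the POINTWISE loop-sum guards `3·|loopSum (linAvgIter s a) c i| < 1` (`s < K − n`); ★w5-20520 g8's located geometry ✓`LinearLiftFlux.abs_loopSum_linAvgIter_le_of_curl_off_corner`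
(✓p676935: no (0.4) loop of any coarse bond sees a wrap-corner plaquette) bounds those loop sums by `(π/2)·((5L)²/4)·Bs s` from curl rows OFF the corner columns `{x : x_μ = −1 ∧ x_ν = −1}` —
exactly where the flux cochain's integer defect sits.  THIS FILE composes the two: ★★★ `diag_mem_fibre_diag_of_curl_off_corner_T3` — fibre membership from the per-level off-corner curl rows
`|curl (linAvgIter s a)| ≤ Bs s` and the windows `30·L²·Bs s ≤ 1` (arithmetic `3·(π/2)(25/4)/30 = 75π/240 < 1`); plus the equation form `descendTo_diag_eq_of_curl_off_corner_T3`,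
and the `sub` forms `gexpAt_I_smul_sigma3_sub_two_pi_mul_int` ∕ `gexpAt_I_smul_sigma3_eq_sub_two_pi_mul_int` of the 2π-periodicity (★px6 g3's ask: the re-lettered angles `θ − 2π·s`).
HONEST SCOPE.  Composition of two landed theorems and one numeric inequality; no estimate of [7]∕[4]; nothing of EX∕the crux∕`hSymCentre` is proved or claimed; the lift `a`, its curl
rows (★px19 (R3), ★w5 FLUX-LIFT∕ZCLASS) and the (R4) assembly (★px6) are not here.

References: T. Bałaban, CMP 109 (1987) [Balaban1987RG1] ((0.4), (0.11) p.253); CMP 98 (1985) [Balaban1985Averaging] ((19)–(20) p.21); CMP 102 (1985) [Balaban1985Variational] ((2) p.278).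
-/

set_option autoImplicit false

noncomputable section

open scoped BigOperators Matrix.Norms.L2Operator Matrix

namespace Summit.QuantumFields.YangMills.Theorems.Prop7SymCentreAbelianFibre

open Literature.MathematicalPhysics.QuantumFieldTheory.Balaban1983to89
open Literature.MathematicalPhysics.QuantumFieldTheory.Balaban1983to89.T4Continuum
open Literature.MathematicalPhysics.QuantumFieldTheory.Balaban1983to89.T3ContinuumYM3Torus (T3Family)
open Literature.MathematicalPhysics.QuantumFieldTheory.Balaban1983to89.T3TiltDescent (descendTo)
open Literature.MathematicalPhysics.QuantumFieldTheory.Balaban1983to89.T3ConstrainedMinimiser (fibre)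
open Literature.MathematicalPhysics.QuantumFieldTheory.Balaban1983to89.T3PrintedRegularOrbits (sites_eq)
open Literature.MathematicalPhysics.QuantumFieldTheory.Balaban1983to89.T3LevelShift (fieldShift bondShift fieldShift_apply)
open Literature.MathematicalPhysics.QuantumFieldTheory.Balaban1983to89.T3UnitLawDensityEML (ℰp)
open Literature.MathematicalPhysics.QuantumFieldTheory.Balaban1983to89.ExpMeanLog (expMeanLogSU deltaSU)
open Literature.MathematicalPhysics.QuantumFieldTheory.Balaban1983to89.BlockAveraging (Idx)
open Literature.MathematicalPhysics.QuantumFieldTheory.Balaban1983to89.B9AdOrthogonal (σ₃)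
open Summit.QuantumFields.Balaban3D.Carriers (suGroupModel)
open Summit.QuantumFields.YangMills.Theorems.BalabanUVNodesN08AlphaAbelianLift (gexp)
open Summit.QuantumFields.YangMills.Theorems.AbelianEML (gexpAt linAvgIter loopSum curlAt)
open Summit.QuantumFields.YangMills.Theorems.AvgActionDefect (deltaSU_fin_two)
open Summit.QuantumFields.YangMills.Theorems.Prop7SymCentreAbelianDict (I_smul_sigma3_mem_lie)
open Summit.QuantumFields.YangMills.Theorems.LinearLiftFlux (abs_loopSum_linAvgIter_le_of_curl_off_corner)

section Sigma3

/-- The `sub` form of ✓`gexpAt_I_smul_sigma3_add_two_pi_mul_int` (★px6 g3's ask for the (R4) assembly): `gexpAt (iσ₃) (a − 2π·m) = gexpAt (iσ₃) a` for every `ℤ`-valued cochain `m`. [folklore] -/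
theorem gexpAt_I_smul_sigma3_sub_two_pi_mul_int {P : Params} {j : ℕ} (a : PBond P j → ℝ) (m : PBond P j → ℤ) :
    gexpAt (suGroupModel 2) I_smul_sigma3_mem_lie (fun b => a b - 2 * Real.pi * (m b : ℝ)) = gexpAt (suGroupModel 2) I_smul_sigma3_mem_lie a := by
  have h := gexpAt_I_smul_sigma3_add_two_pi_mul_int a (fun b => -m b)
  refine Eq.trans ?_ h
  congr 1
  funext b
  push_cast
  ring

/-- The same read from the right: `gexpAt (iσ₃) θ = gexpAt (iσ₃) (θ − 2π·s)` — the RE-LETTERED coarse angles of the flux recipe denote the same coarse field. [folklore] -/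
theorem gexpAt_I_smul_sigma3_eq_sub_two_pi_mul_int {P : Params} {j : ℕ} (θ : PBond P j → ℝ) (s : PBond P j → ℤ) :
    gexpAt (suGroupModel 2) I_smul_sigma3_mem_lie θ = gexpAt (suGroupModel 2) I_smul_sigma3_mem_lie (fun b => θ b - 2 * Real.pi * (s b : ℝ)) :=
  (gexpAt_I_smul_sigma3_sub_two_pi_mul_int θ s).symm

end Sigma3

section T3

variable (F : T3Family) {n K : ℕ}

/-- The per-level window `30·L²·Bs s ≤ 1` turns ★w5's off-corner loop-sum bound into the loop-sum guard of ✓`iter_blockAvg_gexpAt_of_loopSum_lt` at the direction `iσ₃`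
(local arithmetic: `(π/2)·(25L²/4)·Bs s ≤ 75π/240 < 1/3 = min(δ₂, ln 2)`). [folklore] -/
theorem loopGuard_of_curl_off_corner_T3 (h : n ≤ K) (a : PBond (F.P K) 0 → ℝ) (Bs : ℕ → ℝ) (hB0 : ∀ s, 0 ≤ Bs s)
    (hB : ∀ s, s < K - n → ∀ (x : Site (F.P K) s) (μ ν : Fin (F.P K).d), μ ≠ ν → ¬ (x μ = -1 ∧ x ν = -1) → |curlAt (linAvgIter s a) x μ ν| ≤ Bs s)
    (hwin : ∀ s, s < K - n → 30 * (F.L : ℝ) ^ 2 * Bs s ≤ 1) :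
    ∀ s, s < K - n → ∀ (c : PBond (F.P K) (s + 1)) (i : Idx (F.P K)),
      |loopSum (linAvgIter s a) c i| * ‖(Complex.I • σ₃ : Matrix (Fin 2) (Fin 2) ℂ)‖ < min (deltaSU (Fin 2)) (Real.log 2) := by
  intro s hs c i
  have hk : K - n ≤ (F.P K).m + (F.P K).K := by show K - n ≤ F.m + K; omega
  have hloop := abs_loopSum_linAvgIter_le_of_curl_off_corner (suGroupModel 2) I_smul_sigma3_mem_lie I_smul_sigma3_ne_zero (K - n) hk a Bs hB0 hB s hs c i
  have hd : (F.P K).d = 3 := rfl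
  have hL : (F.P K).L = F.L := rfl
  rw [hd, hL] at hloop
  rw [norm_I_smul_sigma3, mul_one, deltaSU_fin_two, min_eq_left (by have := Real.log_two_gt_d9; norm_num at this ⊢; linarith)]
  have h5 : ((((3 + 2) * F.L : ℕ) : ℝ)) ^ 2 / 4 = 25 / 4 * (F.L : ℝ) ^ 2 := by push_cast; ring
  rw [h5] at hloop
  have hpi := Real.pi_lt_d2
  have hw := hwin s hs
  have hBs := hB0 s
  nlinarith [mul_nonneg (sq_nonneg (F.L : ℝ)) hBs, Real.pi_pos]

/-- ★★★ **R4-FIBRE ∘ FLUX-LIFT §7 — THE FLUX MEMBER'S FIBRE CONJUNCT FROM OFF-CORNER CURL ROWS**: for a finest real one-form `a` on run `K` whose iterated linear averages have curls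
`≤ Bs s` OFF the wrap-corner columns at every level `s < K − n` (the integer defect of a standard-form flux cochain sits ON them), with `30·L²·Bs s ≤ 1`, and whose `(K−n)`-fold linear
average read on the `n`-th tower is `θ`: `exp(a·iσ₃) ∈ fibre F ℰp n K h (exp(θ·iσ₃))` — no global curl row, no region, no string relocation.
[cite: Balaban1987RG1, (0.4)+(0.11) p.253; Balaban1985Averaging, (19)-(20) p.21; Balaban1985Variational, (2) p.278] -/
theorem diag_mem_fibre_diag_of_curl_off_corner_T3 (h : n ≤ K) (a : PBond (F.P K) 0 → ℝ) (θ : PBond (F.P n) 0 → ℝ) (Bs : ℕ → ℝ) (hB0 : ∀ s, 0 ≤ Bs s)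
    (hB : ∀ s, s < K - n → ∀ (x : Site (F.P K) s) (μ ν : Fin (F.P K).d), μ ≠ ν → ¬ (x μ = -1 ∧ x ν = -1) → |curlAt (linAvgIter s a) x μ ν| ≤ Bs s)
    (hwin : ∀ s, s < K - n → 30 * (F.L : ℝ) ^ 2 * Bs s ≤ 1)
    (hθ : ∀ c : PBond (F.P n) 0, linAvgIter (K - n) a (bondShift (sites_eq F n K h) c) = θ c) :
    gexpAt (suGroupModel 2) I_smul_sigma3_mem_lie a ∈ fibre F ℰp n K h (gexpAt (suGroupModel 2) I_smul_sigma3_mem_lie θ) :=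
  gexpAt_mem_fibre_gexpAt_of_loopSum_lt F I_smul_sigma3_mem_lie h a (loopGuard_of_curl_off_corner_T3 F h a Bs hB0 hB hwin) θ hθ

/-- The equation form: `descendTo F ℰp n K h (exp(a·iσ₃)) = fieldShift (sites_eq F n K h) (exp((linAvgIter (K−n) a)·iσ₃))` from the off-corner curl rows and windows.
[cite: Balaban1987RG1, (0.4)+(0.11) p.253] -/
theorem descendTo_diag_eq_of_curl_off_corner_T3 (h : n ≤ K) (a : PBond (F.P K) 0 → ℝ) (Bs : ℕ → ℝ) (hB0 : ∀ s, 0 ≤ Bs s)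
    (hB : ∀ s, s < K - n → ∀ (x : Site (F.P K) s) (μ ν : Fin (F.P K).d), μ ≠ ν → ¬ (x μ = -1 ∧ x ν = -1) → |curlAt (linAvgIter s a) x μ ν| ≤ Bs s)
    (hwin : ∀ s, s < K - n → 30 * (F.L : ℝ) ^ 2 * Bs s ≤ 1) :
    descendTo F ℰp n K h (gexpAt (suGroupModel 2) I_smul_sigma3_mem_lie a) =
      fieldShift (sites_eq F n K h) (gexpAt (suGroupModel 2) I_smul_sigma3_mem_lie (linAvgIter (K - n) a)) :=
  descendTo_gexpAt_eq_fieldShift_of_loopSum_lt F I_smul_sigma3_mem_lie h a (loopGuard_of_curl_off_corner_T3 F h a Bs hB0 hB hwin)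

end T3

end Summit.QuantumFields.YangMills.Theorems.Prop7SymCentreAbelianFibre

end
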